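import Literature.NumberTheory.LFunctions.MertensSecondLogPower
import HarnessLib

/-!
# Mertens' first and second theorems with the de la Vallée Poussin error term

Topic `Literature/NumberTheory/LFunctions`, continuing `MertensSecondLogPower.lean` (log-power error
terms). Everything in this file is PROVED (no named facts, no `sorry`):

* `abs_mertensTau_sub_const_le_expSqrt` — Mertens' first theorem with its constant:
  `|∑_{p ≤ x} log p/p - log x - E| ≤ K exp(-c√log x)` (`x ≥ 2`) for some absolute `c > 0`, `K`;
* `abs_primeRecipSum_sub_loglog_sub_le_expSqrt` — **Mertens' second theorem with the classical
  error term**: `|∑_{p ≤ x} 1/p - log log x - B₁| ≤ K exp(-c√log x)` (`x ≥ 2`), `B₁` the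
  Meissel–Mertens constant (`meisselMertens`);
* `abs_primeRecipSum_window_sub_le_expSqrt` — the window form used in partial-summation arguments
  "by the prime number theorem": for `2 ≤ u ≤ v`,
  `|∑_{u < p ≤ v} 1/p - (log log v - log log u)| ≤ K exp(-c√log u)`
  (e.g. Granville–Soundararajan 2003, proof of Lemma 2.3: "`∑_{w ≤ p ≤ z} 1/p = ∫_w^z dt/(t log t)
  + O(exp(-c√log w))`").

Source of the error term: the tree's PROVED prime number theorem
`Literature.NumberTheory.LFunctions.ChebyshevThetaDeLaValleePoussin_holds` (`|ϑ(x) - x| ≤ C x exp(-c√log x)`), fed through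
the exact partial-summation identities of `MertensSecondLogPower.lean`
(`mertensTau_sub_const_eq`, `primeRecipSum_sub_loglog_sub_eq`). The tail integral
`∫_x^∞ exp(-c√log t) dt/t` is handled by `exp(-2c√log t) ≤ exp(-c√log x) · 24/(c⁴ log² t)` (`t ≥ x`,
Taylor), which costs a factor `2` in the exponent constant `c` (immaterial: `c` is unspecified).
These are (2.15)–(2.16) of Montgomery–Vaughan Thm 2.7 with the error term of their Thm 6.9, as
stated in the remark following Thm 6.9 (§6.2).

## References

* H. L. Montgomery, R. C. Vaughan, *Multiplicative Number Theory I. Classical Theory*, CUP 2007,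
  Thm 2.7 (b), (d), Thm 6.9 and the remark following it (§6.2). [MontgomeryVaughan2007]
* A. Granville, K. Soundararajan, *Decay of mean values of multiplicative functions*, Canad. J.
  Math. 55 (2003), proof of Lemma 2.3 (arXiv math/9911246 p. 5). [GranvilleSoundararajan2003]
-/

noncomputable section

open Filter Topology Set MeasureTheory Finset Real
open scoped Chebyshev

namespace Literature.NumberTheory.LFunctions.Mertens

/-! ### The de la Vallée Poussin weight `exp(-c√log t)` -/

/-- Monotonicity of the weight: `exp(-c√log t) ≤ exp(-c√log x)` for `0 < x ≤ t`, `0 ≤ c`. [folklore] -/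
theorem exp_neg_mul_sqrt_log_le {c x t : ℝ} (hc : 0 ≤ c) (hx : 0 < x) (hxt : x ≤ t) :
    Real.exp (-(c * Real.sqrt (Real.log t))) ≤ Real.exp (-(c * Real.sqrt (Real.log x))) := by
  apply Real.exp_le_exp.mpr
  have := Real.sqrt_le_sqrt (Real.log_le_log hx hxt)
  nlinarith

/-- The prime number theorem with the de la Vallée Poussin error term, with the exponent constant
halved for convenience: there are `c > 0` and `C ≥ 0` with
`|ϑ(t) - t| ≤ C t exp(-c√log t)²` for `t ≥ 2` (PROVED in the tree:
`ChebyshevThetaDeLaValleePoussin_holds`). [cite: MontgomeryVaughan2007, Theorem 6.9 (6.13)] -/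
theorem exists_abs_theta_sub_le_expSqrt_sq :
    ∃ c : ℝ, 0 < c ∧ ∃ C : ℝ, 0 ≤ C ∧ ∀ t : ℝ, 2 ≤ t →
      |θ t - t| ≤ C * t * Real.exp (-(c * Real.sqrt (Real.log t))) ^ 2 := by
  obtain ⟨c, hc, C, hC⟩ := ChebyshevThetaDeLaValleePoussin_holds
  refine ⟨c / 2, by positivity, max C 0, le_max_right _ _, fun t ht ↦ ?_⟩
  have ht0 : 0 < t := by linarith
  have hsq : Real.exp (-(c / 2 * Real.sqrt (Real.log t))) ^ 2 =
      (Real.exp (c * Real.sqrt (Real.log t)))⁻¹ := by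
    rw [← Real.exp_nat_mul, ← Real.exp_neg]
    congr 1
    push_cast
    ring
  rw [hsq]
  calc |θ t - t| ≤ C * t / Real.exp (c * Real.sqrt (Real.log t)) := hC t ht
    _ ≤ max C 0 * t / Real.exp (c * Real.sqrt (Real.log t)) := by
        gcongr
        exact le_max_left _ _
    _ = max C 0 * t * (Real.exp (c * Real.sqrt (Real.log t)))⁻¹ := div_eq_mul_inv _ _

/-! ### Mertens' first theorem with the de la Vallée Poussin error term -/

/-- **Mertens' first theorem with its constant and the classical error term**: there are `c > 0`
and `K` with `|∑_{p ≤ x} log p/p - log x - E| ≤ K exp(-c√log x)` for all `x ≥ 2`, where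
`E = 1 - log 2 + ∫_2^∞ (ϑ(t) - t) dt/t²` — from `|ϑ(x) - x| ≤ C x exp(-2c√log x)` by partial summation
(Montgomery–Vaughan §6.2: Thm 2.7 (b) with the error term of Thm 6.9).
[cite: MontgomeryVaughan2007, Thm 2.7 (b) and §6.2] -/
theorem abs_mertensTau_sub_const_le_expSqrt :
    ∃ c : ℝ, 0 < c ∧ ∃ K : ℝ, ∀ x : ℝ, 2 ≤ x →
      |mertensTau x - (1 - Real.log 2 + ∫ t in Ioi 2, (θ t - t) / t ^ 2)| ≤
        K * Real.exp (-(c * Real.sqrt (Real.log x))) := by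
  obtain ⟨c, hc, C, hC0, hC⟩ := exists_abs_theta_sub_le_expSqrt_sq
  refine ⟨c, hc, C + 24 / c ^ 4 * C / Real.log 2, fun x hx ↦ ?_⟩
  have hx1 : 1 < x := by linarith
  have hx0 : 0 < x := by linarith
  have hl : 0 < Real.log x := Real.log_pos hx1
  have hl2 : 0 < Real.log 2 := Real.log_pos one_lt_two
  have hl2x : Real.log 2 ≤ Real.log x := Real.log_le_log two_pos hx
  set w : ℝ := Real.exp (-(c * Real.sqrt (Real.log x))) with hw
  have hw0 : 0 < w := Real.exp_pos _
  have hw1 : w ≤ 1 := by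
    rw [hw, Real.exp_le_one_iff (x := -(c * Real.sqrt (Real.log x)))]
    have := Real.sqrt_nonneg (Real.log x)
    nlinarith
  rw [mertensTau_sub_const_eq hx]
  -- the boundary term `|ϑ(x) - x|/x ≤ C w² ≤ C w`
  have h1 : |(θ x - x) / x| ≤ C * w := by
    rw [abs_div, abs_of_pos hx0, div_le_iff₀ hx0]
    calc |θ x - x| ≤ C * x * w ^ 2 := hC x hx
      _ ≤ C * x * w := by
          refine mul_le_mul_of_nonneg_left ?_ (by positivity)
          nlinarith
      _ = C * w * x := by ring
  -- the tail integral: `|ϑ(t) - t|/t² ≤ C w · (24/c⁴) · t⁻¹/log² t` for `t > x`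
  have h2 : |∫ t in Ioi x, (θ t - t) / t ^ 2| ≤ 24 / c ^ 4 * C * w / Real.log x := by
    have hwint : IntegrableOn (fun t : ℝ ↦ t⁻¹ / Real.log t ^ 2) (Ioi x) :=
      integrableOn_inv_div_log_pow hx1 0
    have hbound : ∀ᵐ t ∂(volume.restrict (Ioi x)),
        ‖(θ t - t) / t ^ 2‖ ≤ 24 / c ^ 4 * C * w * (t⁻¹ / Real.log t ^ 2) := by
      rw [ae_restrict_iff' measurableSet_Ioi]
      refine Eventually.of_forall fun t ht ↦ ?_
      have hxt : x < t := ht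
      have ht0 : 0 < t := by linarith
      have hlt : 0 < Real.log t := Real.log_pos (hx1.trans hxt)
      rw [Real.norm_eq_abs, abs_div, abs_of_pos (by positivity : (0 : ℝ) < t ^ 2),
        div_le_iff₀ (by positivity)]
      have hmono : Real.exp (-(c * Real.sqrt (Real.log t))) ≤ w :=
        exp_neg_mul_sqrt_log_le hc.le hx0 hxt.le
      -- Taylor: `y⁴/4! ≤ e^y` at `y = c√log t` (cf. `MoebiusSum.exp_neg_mul_sqrt_le`)
      have htay : Real.exp (-(c * Real.sqrt (Real.log t))) ≤ 24 / (c ^ 4 * Real.log t ^ 2) := by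
        have h := pow_mul_pow_div_factorial_le_exp_sqrt hc.le hlt.le 2
        norm_num [Nat.factorial] at h
        rw [Real.exp_neg, inv_le_comm₀ (Real.exp_pos _) (by positivity), inv_div]
        linarith
      have he0 : 0 ≤ Real.exp (-(c * Real.sqrt (Real.log t))) := (Real.exp_pos _).le
      calc |θ t - t| ≤ C * t * Real.exp (-(c * Real.sqrt (Real.log t))) ^ 2 := hC t (by linarith)
        _ = C * t * (Real.exp (-(c * Real.sqrt (Real.log t))) *
              Real.exp (-(c * Real.sqrt (Real.log t)))) := by rw [sq]
        _ ≤ C * t * (w * (24 / (c ^ 4 * Real.log t ^ 2))) := by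
            gcongr
        _ = 24 / c ^ 4 * C * w * (t⁻¹ / Real.log t ^ 2) * t ^ 2 := by
            have hlne : Real.log t ≠ 0 := hlt.ne'
            field_simp
    calc |∫ t in Ioi x, (θ t - t) / t ^ 2|
        = ‖∫ t in Ioi x, (θ t - t) / t ^ 2‖ := rfl
      _ ≤ ∫ t in Ioi x, 24 / c ^ 4 * C * w * (t⁻¹ / Real.log t ^ 2) :=
          norm_integral_le_of_norm_le (hwint.const_mul _) hbound
      _ = 24 / c ^ 4 * C * w * ((((0 : ℕ) : ℝ) + 1) * Real.log x ^ (0 + 1))⁻¹ := by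
          rw [integral_const_mul, integral_Ioi_inv_div_log_pow hx1 0]
      _ = 24 / c ^ 4 * C * w / Real.log x := by simp [div_eq_mul_inv]
  have h2' : 24 / c ^ 4 * C * w / Real.log x ≤ 24 / c ^ 4 * C / Real.log 2 * w := by
    rw [div_le_iff₀ hl]
    calc 24 / c ^ 4 * C * w = 24 / c ^ 4 * C / Real.log 2 * w * Real.log 2 := by
          field_simp
      _ ≤ 24 / c ^ 4 * C / Real.log 2 * w * Real.log x := by gcongr
  calc |(θ x - x) / x - ∫ t in Ioi x, (θ t - t) / t ^ 2|
      ≤ |(θ x - x) / x| + |∫ t in Ioi x, (θ t - t) / t ^ 2| := abs_sub _ _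
    _ ≤ C * w + 24 / c ^ 4 * C / Real.log 2 * w := by linarith [h1, h2, h2']
    _ = (C + 24 / c ^ 4 * C / Real.log 2) * w := by ring

/-! ### Mertens' second theorem with the de la Vallée Poussin error term -/

/-- **Mertens' second theorem with the classical error term**: there are `c > 0` and `K` with
`|∑_{p ≤ x} 1/p - log log x - B₁| ≤ K exp(-c√log x)` for all `x ≥ 2`, `B₁` the Meissel–Mertens
constant (Montgomery–Vaughan (2.15) with the error term of Thm 6.9, §6.2).
[cite: MontgomeryVaughan2007, Thm 2.7 (d) and §6.2] -/
theorem abs_primeRecipSum_sub_loglog_sub_le_expSqrt :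
    ∃ c : ℝ, 0 < c ∧ ∃ K : ℝ, ∀ x : ℝ, 2 ≤ x →
      |primeRecipSum x - Real.log (Real.log x) - meisselMertens| ≤
        K * Real.exp (-(c * Real.sqrt (Real.log x))) := by
  obtain ⟨c, hc, K, hK⟩ := abs_mertensTau_sub_const_le_expSqrt
  set E : ℝ := 1 - Real.log 2 + ∫ t in Ioi 2, (θ t - t) / t ^ 2 with hE
  have hl2 : 0 < Real.log 2 := Real.log_pos one_lt_two
  have hK0 : 0 ≤ K := by
    have h := (abs_nonneg _).trans (hK 2 le_rfl)
    have he : 0 < Real.exp (-(c * Real.sqrt (Real.log 2))) := Real.exp_pos _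
    nlinarith
  refine ⟨c, hc, K / Real.log 2 + K / Real.log 2, fun x hx ↦ ?_⟩
  have hx1 : 1 < x := by linarith
  have hx0 : 0 < x := by linarith
  have hl : 0 < Real.log x := Real.log_pos hx1
  have hl2x : Real.log 2 ≤ Real.log x := Real.log_le_log two_pos hx
  set w : ℝ := Real.exp (-(c * Real.sqrt (Real.log x))) with hw
  have hw0 : 0 < w := Real.exp_pos _
  rw [primeRecipSum_sub_loglog_sub_eq hx E]
  have h1 : |(mertensTau x - E) / Real.log x| ≤ K / Real.log 2 * w := by
    rw [abs_div, abs_of_pos hl, div_le_iff₀ hl]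
    calc |mertensTau x - E| ≤ K * w := hK x hx
      _ = K / Real.log 2 * w * Real.log 2 := by field_simp
      _ ≤ K / Real.log 2 * w * Real.log x := by gcongr
  have h2 : |∫ t in Ioi x, (mertensTau t - E) * (t⁻¹ / Real.log t ^ 2)| ≤ K / Real.log 2 * w := by
    have hKw : ∀ t : ℝ, x < t → |mertensTau t - E| ≤ K * w / Real.log t ^ 0 := by
      intro t hxt
      rw [pow_zero, div_one]
      calc |mertensTau t - E| ≤ K * Real.exp (-(c * Real.sqrt (Real.log t))) := hK t (by linarith)
        _ ≤ K * w := mul_le_mul_of_nonneg_left (exp_neg_mul_sqrt_log_le hc.le hx0 hxt.le) hK0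
    have h := abs_integral_Ioi_mul_inv_div_log_pow_le hx1 0 0 (by positivity) hKw
    refine h.trans ?_
    rw [pow_one, div_le_iff₀ hl]
    calc K * w = K / Real.log 2 * w * Real.log 2 := by field_simp
      _ ≤ K / Real.log 2 * w * Real.log x := by gcongr
  calc |(mertensTau x - E) / Real.log x -
        ∫ t in Ioi x, (mertensTau t - E) * (t⁻¹ / Real.log t ^ 2)|
      ≤ |(mertensTau x - E) / Real.log x| +
        |∫ t in Ioi x, (mertensTau t - E) * (t⁻¹ / Real.log t ^ 2)| := abs_sub _ _
    _ ≤ K / Real.log 2 * w + K / Real.log 2 * w := add_le_add h1 h2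
    _ = (K / Real.log 2 + K / Real.log 2) * w := by ring

/-- The same with the sum written out: `|∑_{p ≤ x} 1/p - (log log x + B₁)| ≤ K exp(-c√log x)`
(`x ≥ 2`). [cite: MontgomeryVaughan2007, Thm 2.7 (d) and §6.2] -/
theorem abs_sum_primesLE_inv_sub_loglog_le_expSqrt :
    ∃ c : ℝ, 0 < c ∧ ∃ K : ℝ, ∀ x : ℝ, 2 ≤ x →
      |(∑ p ∈ Nat.primesLE ⌊x⌋₊, (p : ℝ)⁻¹) - (Real.log (Real.log x) + meisselMertens)| ≤
        K * Real.exp (-(c * Real.sqrt (Real.log x))) := by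
  obtain ⟨c, hc, K, hK⟩ := abs_primeRecipSum_sub_loglog_sub_le_expSqrt
  refine ⟨c, hc, K, fun x hx ↦ ?_⟩
  have := hK x hx
  rw [primeRecipSum] at this
  rwa [← sub_sub]

/-! ### The window form -/

/-- The primes of `(u, v]` as a difference of two initial segments: for `0 ≤ u ≤ v`,
`∑_{p ≤ v, u < p} h(p) = ∑_{p ≤ v} h(p) - ∑_{p ≤ u} h(p)`. [folklore] -/
theorem sum_primesLE_filter_lt_eq_sub (h : ℕ → ℝ) {u v : ℝ} (hu : 0 ≤ u) (huv : u ≤ v) :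
    ∑ p ∈ (Nat.primesLE ⌊v⌋₊).filter (fun p : ℕ => u < (p : ℝ)), h p =
      ∑ p ∈ Nat.primesLE ⌊v⌋₊, h p - ∑ p ∈ Nat.primesLE ⌊u⌋₊, h p := by
  have hsplit := Finset.sum_filter_add_sum_filter_not (Nat.primesLE ⌊v⌋₊) (fun p : ℕ => u < (p : ℝ)) h
  have hset : (Nat.primesLE ⌊v⌋₊).filter (fun p : ℕ => ¬ u < (p : ℝ)) = Nat.primesLE ⌊u⌋₊ := by
    ext p
    simp only [Finset.mem_filter, Nat.mem_primesLE, not_lt]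
    constructor
    · rintro ⟨⟨-, hp⟩, hpu⟩
      exact ⟨Nat.le_floor hpu, hp⟩
    · rintro ⟨hpu, hp⟩
      have h1 : (p : ℝ) ≤ u := (Nat.le_floor_iff hu).mp hpu
      exact ⟨⟨Nat.le_floor (h1.trans huv), hp⟩, h1⟩
  rw [hset] at hsplit
  linarith

/-- **Mertens' second theorem in a window, with the classical error term** ("by the prime number
theorem and partial summation, `∑_{u ≤ p ≤ z} 1/p = ∫_u^z dt/(t log t) + O(exp(-c√log u))`",
Granville–Soundararajan 2003, proof of Lemma 2.3): there are `c > 0` and `K` such that for all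
`2 ≤ u ≤ v`, `|(∑_{p ≤ v} 1/p - ∑_{p ≤ u} 1/p) - (log log v - log log u)| ≤ K exp(-c√log u)`.
[cite: GranvilleSoundararajan2003, proof of Lemma 2.3] -/
theorem abs_primeRecipSum_window_sub_le_expSqrt :
    ∃ c : ℝ, 0 < c ∧ ∃ K : ℝ, ∀ u v : ℝ, 2 ≤ u → u ≤ v →
      |primeRecipSum v - primeRecipSum u - (Real.log (Real.log v) - Real.log (Real.log u))| ≤
        K * Real.exp (-(c * Real.sqrt (Real.log u))) := by
  obtain ⟨c, hc, K, hK⟩ := abs_primeRecipSum_sub_loglog_sub_le_expSqrt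
  have hK0 : 0 ≤ K := by
    have h := (abs_nonneg _).trans (hK 2 le_rfl)
    have he : 0 < Real.exp (-(c * Real.sqrt (Real.log 2))) := Real.exp_pos _
    nlinarith
  refine ⟨c, hc, K + K, fun u v hu huv ↦ ?_⟩
  have hv := hK v (hu.trans huv)
  have hu' := hK u hu
  have hmono : Real.exp (-(c * Real.sqrt (Real.log v))) ≤ Real.exp (-(c * Real.sqrt (Real.log u))) :=
    exp_neg_mul_sqrt_log_le hc.le (by linarith) huv
  rw [abs_le] at hv hu' ⊢
  constructor <;> nlinarith [hv.1, hv.2, hu'.1, hu'.2, hmono]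

/-- The window form over the primes of `(u, v]`: for `2 ≤ u ≤ v`,
`|∑_{u < p ≤ v} 1/p - (log log v - log log u)| ≤ K exp(-c√log u)`.
[cite: GranvilleSoundararajan2003, proof of Lemma 2.3] -/
theorem abs_sum_inv_prime_window_sub_le_expSqrt :
    ∃ c : ℝ, 0 < c ∧ ∃ K : ℝ, ∀ u v : ℝ, 2 ≤ u → u ≤ v →
      |(∑ p ∈ (Nat.primesLE ⌊v⌋₊).filter (fun p : ℕ => u < (p : ℝ)), (p : ℝ)⁻¹) -
          (Real.log (Real.log v) - Real.log (Real.log u))| ≤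
        K * Real.exp (-(c * Real.sqrt (Real.log u))) := by
  obtain ⟨c, hc, K, hK⟩ := abs_primeRecipSum_window_sub_le_expSqrt
  refine ⟨c, hc, K, fun u v hu huv ↦ ?_⟩
  rw [sum_primesLE_filter_lt_eq_sub _ (by linarith) huv]
  exact hK u v hu huv

end Literature.NumberTheory.LFunctions.Mertens
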